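import Summits.Schanuel.Schanuel.Theorems.RootDecomp1KGeneric13

/-!
# RootDecomp1K — lens 6, generation 14: the LOG-SQUARE CARVING (barrier complement of NW 1996 Thm 1)

Node of `route-Schanuel-RootDecomp1K` (DRAFT rev 8; `closes hL hH hF hB`).  PATH T (theorem round):
no item / split / kind / `closes` edit; everything here is `--supports` material for the open
cruxes `CoordLiouvilleSchanuel` (stmt-Schanuel-31077, r2) and `FiniteOrderLiouvilleSchanuel`
(stmt-Schanuel-33364, A₄ᵈ) and for `HyperLiouvilleSchanuel` (33363, A₄ʰ).

## The move

Nesterenko–Waldschmidt 1996, Theorem 1 (tree: `NesterenkoWaldschmidt1996_thm_1`, a cited, unproved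
Literature fact carried as the hypothesis `hNW` exactly as in parts Generic01–13) bounds
`|e^θ − α| + |θ − β|` below by `exp(−211·D·F₁·F₂·F₃)` where, at BOUNDED degree `D` and heights
`h(α), h(β) ≤ L`, the product `F₁·F₂` is QUADRATIC in `L` — the «product form» of the wall
(`Literature.Barriers.Schanuel.LargeTranscendenceDegree`, and §9d of the lineage: the sum form
`(D·h)^{−c}` is the open Lang–Waldschmidt shape).  Reading the wall at `β = p/q`, `L ≍ log q`, with
the auxiliary parameter `E := e`, the measure is `exp(−C (log q)²)`: it defeats every approximation
`|ℓ − p/q| < q^{−N log q}` with `N` LARGE.  (Optimising `E ≍ log q` in the typed fact gains exactly one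
factor `log log q` in the exponent — wall `exp(−C (log q)²/log log q)` — and no more, since `F₂ ≥ 2E|θ|`
forces `log E ≲ log log q`; g14 works at `E = e`, i.e. within that `log log` factor of the exact
complement; the factor is bookkeeping for an addendum, not a different mechanism.)  Round 4 (Hyper08/19,
`algebraicIndependent_exp_of_hyperLiouville[_NW]`) and round 9 (Generic13, exponential order `k`)
only carved the reals with `|ℓ − p/q| < exp(−q^k)` — exponentially far inside the decidable region.

**g14 carves the complement of the wall at the log-square scale**: `LogSqLiouville ℓ`
(«`|ℓ − p/q| < q^{−N log q}` for every `N`», §1) ⟹ `ℓ, e^ℓ` algebraically independent (mod NW96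
Thm 1, §3), hence Schanuel's bound at EVERY pair whose ℚ-span contains such a real (§4) — an
`e^ℓ`-load-bearing decided cell of item 31077 at `n = 2` strictly larger than round 4's
hyper-Liouville cell and round 9's finite-order classes; the same at every pair whose span
contains a PURELY IMAGINARY `iℓ`, `ℓ` log-square Liouville (§3b/§4b: the kernel at `u = iℓ` with the
degree-2 approximants `i·p/q`; flagship twin `algebraicIndependent_exp_I_mul_of_logSqLiouville`);
the formal splits `coordLiouvilleSchanuel_two_split[_axis]` : item 31077 at `n = 2` ⟸ (axis cell) ∧
(residual «no real and no purely imaginary log-square-Liouville axis number in the span», OPEN);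
and (§5, tightness) Liouville's own numbers
`ℓ_b = Σ b^{−k!}` are NOT log-square Liouville (`|ℓ_b − p/q| ≥ exp(−10 (log q)²)`, hypothesis-free),
so the named open cell `(ℓ_b, ℓ_b²)` lies in the residual, on the far side of the wall (also of the
`E`-optimised wall): deciding it REQUIRES beating the product form (sum-form measure; IDEA-NEEDED).

Pieces (tags for the critic):
* P1 `expPair_lower_bound_deg_height`, `not_logSqPairApprox_of_NW` — the two-parameter kernel
  (degree `N`, height `L` separately: `exp(−c_NW₂(|u|)·N⁵·(1+L)²)`), WEAKER·DECIDED mod NW96.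
* P2 `logSqPairApprox_of_dependent_gen` (engine; instances `logSqPairApprox_of_dependent`,
  `logSqPairApprox_I_mul_of_dependent`) — Liouville extraction in the exponent at log-square quality
  (hypothesis-free), WEAKER·DECIDED.
* P3 `algebraicIndependent_exp_of_logSqLiouville` and the twin
  `algebraicIndependent_exp_I_mul_of_logSqLiouville` — flagships, WEAKER·DECIDED mod NW96.
* P4 cells `logSqCell_any`, `logSqCell_sq`, `sb_two_of_logSqLiouville_mem_span`,
  `sb_two_of_I_mul_logSqLiouville_mem_span`, `logSqTwinCell_any`, `coordLiouvilleSchanuel_two_of_logSq[_axis]`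
  (= item 31077's text at `n = 2` on the sub-scope «a real or purely imaginary log-square-Liouville axis
  number in the span»), DECIDED mod NW96; formal splits `coordLiouvilleSchanuel_two_split[_axis]`.
* P5 `not_logSqLiouville_liouvilleNumber` — tightness / barrier placement, hypothesis-free.
Nothing here proves Schanuel; `(ℓ_b, ℓ_b²)` stays UNDECIDED (it lies in the residual, beyond the
wall).  Sorry-free; standard axioms.
-/

set_option linter.unusedSectionVars false

noncomputable section

open Complex Polynomial

namespace Summit.Schanuel.Schanuel.Theorems.RootDecomp1KGeneric

open Summit.Schanuel.Schanuel.Theorems.RootDecomp1KHyper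
open Summit.Schanuel.Schanuel.Theorems.RootDecomp1KHyper.HyperCell
open Literature.NumberTheory.Transcendental (NesterenkoWaldschmidt1996_thm_1 weilHeight₁)

variable {K : ℕ}

/-! ## §1  Log-square Liouville reals -/

/-- `ρ` is **log-square Liouville**: for every `m` there are rationals `r` of arbitrarily large
denominator `q` with `|ρ − r| < exp(−m (log q)²) = q^{−m log q}`.  Between Mathlib's `Liouville`
(`q^{−m}` for every `m`) and the tree's `HyperLiouville` / `LiouvilleOrder k` (`exp(−q^k)`). -/
def LogSqLiouville (ρ : ℝ) : Prop :=
  ∀ m : ℕ, ∃ r : ℚ, m ≤ r.den ∧ ρ ≠ r ∧ |ρ - r| < Real.exp (-((m : ℝ) * Real.log r.den ^ 2))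

/-- `1 ≤ log x` for `x ≥ 3`. -/
private theorem one_le_log_of_three_le {x : ℝ} (hx : 3 ≤ x) : 1 ≤ Real.log x := by
  rw [Real.le_log_iff_exp_le (by linarith)]
  have := Real.exp_one_lt_d9
  linarith

/-- A log-square Liouville real is Liouville. -/
theorem LogSqLiouville.liouville {ρ : ℝ} (h : LogSqLiouville ρ) : Liouville ρ := by
  intro n
  obtain ⟨r, hden, hne, hlt⟩ := h (n + 3)
  have hd3 : 3 ≤ r.den := le_trans (by omega) hden
  have hd3r : (3 : ℝ) ≤ r.den := by exact_mod_cast hd3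
  have hq0 : (0 : ℝ) < r.den := by linarith
  have hlog1 : 1 ≤ Real.log r.den := one_le_log_of_three_le hd3r
  have hr : (r : ℝ) = (r.num : ℝ) / ((r.den : ℤ) : ℝ) := by
    rw [Int.cast_natCast]; exact Rat.cast_def r
  refine ⟨r.num, r.den, by exact_mod_cast (show 2 ≤ r.den by omega), hr ▸ hne, ?_⟩
  rw [← hr]
  have e : Real.exp (-((n : ℝ) * Real.log r.den)) = 1 / ((r.den : ℤ) : ℝ) ^ n := by
    rw [Int.cast_natCast, Real.exp_neg, Real.exp_nat_mul, Real.exp_log hq0, one_div]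
  rw [← e]
  refine hlt.trans_le (Real.exp_le_exp.mpr (neg_le_neg ?_))
  push_cast
  have hn0 : (0 : ℝ) ≤ n := Nat.cast_nonneg n
  nlinarith [mul_nonneg hn0 (by linarith : (0 : ℝ) ≤ Real.log r.den)]

/-- A log-square Liouville real is irrational. -/
theorem LogSqLiouville.irrational {ρ : ℝ} (h : LogSqLiouville ρ) : Irrational ρ :=
  h.liouville.irrational

/-- A log-square Liouville real is non-zero. -/
theorem LogSqLiouville.ne_zero {ρ : ℝ} (h : LogSqLiouville ρ) : ρ ≠ 0 := h.irrational.ne_zero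

/-- Exponential Liouville order `k ≥ 3` implies log-square Liouville (`m (log q)² ≤ q³ ≤ q^k`). -/
theorem LogSqLiouville.of_liouvilleOrder {ρ : ℝ} {k : ℕ} (h : LiouvilleOrder k ρ) (hk : 3 ≤ k) :
    LogSqLiouville ρ := by
  intro m
  obtain ⟨r, hden, hne, hlt⟩ := h (m + 1)
  refine ⟨r, by omega, hne, hlt.trans_le ?_⟩
  rw [Real.exp_le_exp, neg_le_neg_iff]
  have hq1 : (1 : ℝ) ≤ r.den := by exact_mod_cast r.den_pos
  have hq0 : (0 : ℝ) < r.den := by linarith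
  have hmq : (m : ℝ) ≤ r.den := by exact_mod_cast (show m ≤ r.den by omega)
  have hlog : Real.log r.den ≤ r.den := (Real.log_le_sub_one_of_pos hq0).trans (by linarith)
  have hlog0 : 0 ≤ Real.log r.den := Real.log_nonneg hq1
  calc (m : ℝ) * Real.log r.den ^ 2 ≤ (r.den : ℝ) * (r.den : ℝ) ^ 2 := by
        gcongr
    _ = (r.den : ℝ) ^ 3 := by ring
    _ ≤ (r.den : ℝ) ^ k := pow_le_pow_right₀ hq1 hk

/-- Hyper-Liouville implies log-square Liouville (so the class is non-empty: `λ_H`, Hyper15). -/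
theorem LogSqLiouville.of_hyperLiouville {ρ : ℝ} (h : HyperLiouville ρ) : LogSqLiouville ρ :=
  LogSqLiouville.of_liouvilleOrder (LiouvilleOrder.of_hyperLiouville h 3) le_rfl

/-- The explicit constant `λ_H` of §17d (Hyper15) is log-square Liouville. -/
theorem logSqLiouville_lambdaH : LogSqLiouville lambdaH :=
  LogSqLiouville.of_hyperLiouville hyperLiouville_lambdaH

/-- Log-square Liouville reals are stable under multiplication by a positive integer. -/
theorem LogSqLiouville.nat_mul {ρ : ℝ} (hρ : LogSqLiouville ρ) {M : ℕ} (hM : 1 ≤ M) :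
    LogSqLiouville ((M : ℝ) * ρ) := by
  intro m
  obtain ⟨c, hc⟩ : ∃ c : ℕ, c = ((M : ℚ)⁻¹).den := ⟨_, rfl⟩
  have hc1 : 1 ≤ c := by rw [hc]; exact ((M : ℚ)⁻¹).den_pos
  have hM0 : (M : ℚ) ≠ 0 := by exact_mod_cast (show M ≠ 0 by omega)
  have hMr : (0 : ℝ) < M := by exact_mod_cast (show 0 < M by omega)
  obtain ⟨r, hden, hne, hlt⟩ := hρ (m * c + (M + m + 3))
  refine ⟨(M : ℚ) * r, ?_, ?_, ?_⟩
  · have h1 : r.den ∣ c * ((M : ℚ) * r).den := by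
      have := Rat.mul_den_dvd (M : ℚ)⁻¹ ((M : ℚ) * r)
      rwa [← mul_assoc, inv_mul_cancel₀ hM0, one_mul, ← hc] at this
    have h2 : r.den ≤ c * ((M : ℚ) * r).den :=
      Nat.le_of_dvd (Nat.mul_pos (by omega) ((M : ℚ) * r).den_pos) h1
    have h3 : m * c ≤ c * ((M : ℚ) * r).den := le_trans (le_trans (Nat.le_add_right _ _) hden) h2
    rw [mul_comm] at h3
    exact Nat.le_of_mul_le_mul_left h3 (by omega)
  · push_cast
    intro h
    exact hne (mul_left_cancel₀ hMr.ne' h)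
  · have hq'le : ((M : ℚ) * r).den ≤ r.den := by
      refine Nat.le_of_dvd r.den_pos ?_
      have := Rat.mul_den_dvd (M : ℚ) r
      rwa [show ((M : ℚ)).den = 1 from by simp, one_mul] at this
    have hq3 : 3 ≤ r.den := by omega
    have hq3r : (3 : ℝ) ≤ r.den := by exact_mod_cast hq3
    have hq0 : (0 : ℝ) < r.den := by linarith
    have hq'0 : (0 : ℝ) < ((M : ℚ) * r).den := by exact_mod_cast ((M : ℚ) * r).den_pos
    have hlog1 : 1 ≤ Real.log r.den := one_le_log_of_three_le hq3r
    have hlog'0 : 0 ≤ Real.log ((M : ℚ) * r).den :=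
      Real.log_natCast_nonneg _
    have hlogle : Real.log ((M : ℚ) * r).den ≤ Real.log r.den :=
      Real.log_le_log hq'0 (by exact_mod_cast hq'le)
    set L : ℝ := Real.log r.den with hL
    set L' : ℝ := Real.log ((M : ℚ) * r).den with hL'
    set i : ℕ := m * c + (M + m + 3) with hi
    have habs : |(M : ℝ) * ρ - (((M : ℚ) * r : ℚ) : ℝ)| = (M : ℝ) * |ρ - r| := by
      push_cast
      rw [← mul_sub, abs_mul, abs_of_pos hMr]
    rw [habs]
    have hL2 : 1 ≤ L ^ 2 := by nlinarith
    -- `M · exp(−i L²) ≤ exp(−m L²) ≤ exp(−m L'²)`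
    have him : (M : ℝ) ≤ ((i : ℝ) - m) * L ^ 2 := by
      have : ((i : ℝ) - m) = (m * c + M + 3 : ℝ) := by rw [hi]; push_cast; ring
      rw [this]
      have h0 : (0 : ℝ) ≤ m * c := by positivity
      nlinarith
    have h1 : (M : ℝ) ≤ Real.exp (((i : ℝ) - m) * L ^ 2) :=
      him.trans (by linarith [Real.add_one_le_exp (((i : ℝ) - m) * L ^ 2)])
    have key : (M : ℝ) * Real.exp (-((i : ℝ) * L ^ 2)) ≤ Real.exp (-((m : ℝ) * L ^ 2)) :=
      calc (M : ℝ) * Real.exp (-((i : ℝ) * L ^ 2))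
          ≤ Real.exp (((i : ℝ) - m) * L ^ 2) * Real.exp (-((i : ℝ) * L ^ 2)) :=
            mul_le_mul_of_nonneg_right h1 (Real.exp_pos _).le
        _ = Real.exp (-((m : ℝ) * L ^ 2)) := by rw [← Real.exp_add]; congr 1; ring
    have key2 : Real.exp (-((m : ℝ) * L ^ 2)) ≤ Real.exp (-((m : ℝ) * L' ^ 2)) := by
      rw [Real.exp_le_exp, neg_le_neg_iff]
      have : L' ^ 2 ≤ L ^ 2 := pow_le_pow_left₀ hlog'0 hlogle 2
      exact mul_le_mul_of_nonneg_left this (Nat.cast_nonneg m)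
    have hlt' : (M : ℝ) * |ρ - r| < (M : ℝ) * Real.exp (-((i : ℝ) * L ^ 2)) := by
      have : |ρ - ↑r| < Real.exp (-((i : ℝ) * L ^ 2)) := by rw [hi, hL]; exact_mod_cast hlt
      exact mul_lt_mul_of_pos_left this hMr
    exact hlt'.trans_le (key.trans key2)

/-! ## §2  The two-parameter kernel: NW 1996 Theorem 1 at bounded degree and logarithmic height -/

/-- The constant of the two-parameter pair measure: `211 · 8 · (10 + T)(4 + 3T)`, `T = |u|`. -/
def cNW₂ (T : ℝ) : ℝ := 1688 * (10 + T) * (4 + 3 * T)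

/-- `cNW₂ T > 0` for `T ≥ 0`. -/
theorem cNW₂_pos {T : ℝ} (hT : 0 ≤ T) : 0 < cNW₂ T := by unfold cNW₂; positivity

/-- `2 * Real.exp 1 < 6`. -/
private theorem two_e_lt_six' : 2 * Real.exp 1 < 6 := by
  have := Real.exp_one_lt_d9; linarith

/-- **P1 (kernel, two-parameter form of NW 1996 Thm 1).**  For `u ≠ 0` and non-zero algebraic `α, β`
with `[ℚ(α,β):ℚ] ≤ N` and `h(α), h(β) ≤ L` (`N, L ≥ 1`):
`|e^u − α| + |u − β| ≥ exp(−c_NW₂(|u|) · N⁵ · (1 + L)²)` — QUADRATIC in the height at bounded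
degree (the product form of the wall), versus `(1 + L)^6` in the one-parameter kernel of Generic01. -/
theorem expPair_lower_bound_deg_height (hNW : NesterenkoWaldschmidt1996_thm_1) {u : ℂ} (hu0 : u ≠ 0)
    {α β : ℂ} (hα0 : α ≠ 0) (hβ0 : β ≠ 0) (hα : IsAlgebraic ℚ α) (hβ : IsAlgebraic ℚ β) {N L : ℝ}
    (hN1 : 1 ≤ N) (hL1 : 1 ≤ L)
    (hD : (Module.finrank ℚ ↥(IntermediateField.adjoin ℚ ({α, β} : Set ℂ)) : ℝ) ≤ N)
    (hhα : weilHeight₁ (IntermediateField.adjoin ℚ ({α, β} : Set ℂ)) (fun _ : Unit => α) ≤ L)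
    (hhβ : weilHeight₁ (IntermediateField.adjoin ℚ ({α, β} : Set ℂ)) (fun _ : Unit => β) ≤ L) :
    Real.exp (-(cNW₂ ‖u‖ * N ^ 5 * (1 + L) ^ 2)) ≤ ‖cexp u - α‖ + ‖u - β‖ := by
  set D : ℕ := Module.finrank ℚ (IntermediateField.adjoin ℚ ({α, β} : Set ℂ)) with hDdef
  have hD0 : (0 : ℝ) ≤ D := Nat.cast_nonneg D
  have hΛ2 : (2 : ℝ) ≤ 1 + L := by linarith
  have hΛ0 : (0 : ℝ) ≤ 1 + L := by linarith
  have hN0 : (0 : ℝ) ≤ N := by linarith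
  -- Theorem 1 at `θ = u`, `A = B = e · e^L`, `E = e`
  have hlogA : Real.log (Real.exp 1 * Real.exp L) = 1 + L := by
    rw [Real.log_mul (Real.exp_pos 1).ne' (Real.exp_pos L).ne', Real.log_exp, Real.log_exp]
  have hinvD : (1 : ℝ) / D ≤ 1 := by
    rcases Nat.eq_zero_or_pos D with h | h
    · rw [h]; norm_num
    · exact (div_le_one (by exact_mod_cast h)).mpr (by exact_mod_cast h)
  have hA : max (weilHeight₁ (IntermediateField.adjoin ℚ ({α, β} : Set ℂ)) (fun _ : Unit => α))
      (1 / (D : ℝ)) ≤ Real.log (Real.exp 1 * Real.exp L) := by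
    rw [hlogA]
    exact max_le (by linarith) (by linarith)
  have hB : weilHeight₁ (IntermediateField.adjoin ℚ ({α, β} : Set ℂ)) (fun _ : Unit => β) ≤
      Real.log (Real.exp 1 * Real.exp L) := by
    rw [hlogA]; linarith
  have hmain := hNW u α β (Real.exp 1 * Real.exp L) (Real.exp 1 * Real.exp L) (Real.exp 1) hu0 hα0 hβ0
    hα hβ (by positivity) (by positivity) le_rfl hA hB
  rw [← hDdef, Real.log_exp, hlogA, one_pow, div_one] at hmain
  refine le_trans (Real.exp_le_exp.mpr ?_) hmain
  rw [neg_le_neg_iff]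
  -- the three factors
  set T : ℝ := ‖u‖ with hT
  have hT0 : 0 ≤ T := norm_nonneg u
  have hDN : (D : ℝ) ≤ N := hD
  have hlogD : Real.log D ≤ N := by
    rcases Nat.eq_zero_or_pos D with h | h
    · rw [h]; simp; linarith
    · have := Real.log_le_sub_one_of_pos (by exact_mod_cast h : (0 : ℝ) < D); linarith
  have hlogD0 : 0 ≤ Real.log D := Real.log_natCast_nonneg D
  have hlogΛ : Real.log (1 + L) ≤ 1 + L := by
    have := Real.log_le_sub_one_of_pos (by linarith : (0 : ℝ) < 1 + L); linarith
  have hlogΛ0 : 0 ≤ Real.log (1 + L) := Real.log_nonneg (by linarith)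
  have hlogD2 : Real.log ((D : ℝ) + 2) ≤ 2 * N := by
    have := Real.log_le_sub_one_of_pos (by linarith : (0 : ℝ) < D + 2); linarith
  have hlogD20 : 0 ≤ Real.log ((D : ℝ) + 2) := Real.log_nonneg (by linarith)
  have hmax1 : 1 ≤ max 1 T := le_max_left _ _
  have hlogE : Real.log (Real.exp 1 * max 1 T) ≤ 1 + T := by
    rw [Real.log_mul (Real.exp_pos 1).ne' (by linarith), Real.log_exp]
    have := Real.log_le_sub_one_of_pos (by linarith : (0 : ℝ) < max 1 T)
    have hmaxT : max 1 T ≤ 1 + T := max_le (by linarith) (by linarith)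
    linarith
  have hlogE0 : 0 ≤ Real.log (Real.exp 1 * max 1 T) := Real.log_nonneg
    (one_le_mul_of_one_le_of_one_le (by have := Real.add_one_le_exp (1 : ℝ); linarith) hmax1)
  -- `N Λ ≥ 2` and its multiples
  have hNΛ1 : (1 + L) ≤ N * (1 + L) := le_mul_of_one_le_left hΛ0 hN1
  have hNΛ2 : 2 * N ≤ N * (1 + L) := by nlinarith
  have hNΛ3 : (2 : ℝ) ≤ N * (1 + L) := by nlinarith
  have hNΛT : T * 2 ≤ T * (N * (1 + L)) := mul_le_mul_of_nonneg_left hNΛ3 hT0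
  have f1 : (1 + L) + Real.log (1 + L) + 4 * Real.log D + 2 * Real.log (Real.exp 1 * max 1 T) + 10 ≤
      (10 + T) * (N * (1 + L)) := by nlinarith
  have f1pos : 0 ≤ (1 + L) + Real.log (1 + L) + 4 * Real.log D +
      2 * Real.log (Real.exp 1 * max 1 T) + 10 := by positivity
  have f2 : (D : ℝ) * (1 + L) + 2 * Real.exp 1 * T + 6 * 1 ≤ (4 + 3 * T) * (N * (1 + L)) := by
    have b : 2 * Real.exp 1 * T ≤ 6 * T := mul_le_mul_of_nonneg_right two_e_lt_six'.le hT0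
    have hDΛ : (D : ℝ) * (1 + L) ≤ N * (1 + L) := mul_le_mul_of_nonneg_right hDN hΛ0
    nlinarith
  have f2pos : 0 ≤ (D : ℝ) * (1 + L) + 2 * Real.exp 1 * T + 6 * 1 := by positivity
  have f3 : 33 / 10 * (D : ℝ) * Real.log ((D : ℝ) + 2) + 1 ≤ 8 * N ^ 2 := by
    have hm : (D : ℝ) * Real.log ((D : ℝ) + 2) ≤ N * (2 * N) := mul_le_mul hDN hlogD2 hlogD20 hN0
    nlinarith
  have f3pos : 0 ≤ 33 / 10 * (D : ℝ) * Real.log ((D : ℝ) + 2) + 1 := by positivity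
  have hprod : 211 * (D : ℝ) * ((1 + L) + Real.log (1 + L) + 4 * Real.log D +
        2 * Real.log (Real.exp 1 * max 1 T) + 10) *
        ((D : ℝ) * (1 + L) + 2 * Real.exp 1 * T + 6 * 1) *
        (33 / 10 * (D : ℝ) * Real.log ((D : ℝ) + 2) + 1) ≤
      211 * N * ((10 + T) * (N * (1 + L))) * ((4 + 3 * T) * (N * (1 + L))) * (8 * N ^ 2) := by
    gcongr
  have e : 211 * N * ((10 + T) * (N * (1 + L))) * ((4 + 3 * T) * (N * (1 + L))) * (8 * N ^ 2) =
      cNW₂ T * N ^ 5 * (1 + L) ^ 2 := by unfold cNW₂; ring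
  linarith [hprod, e]

/-- **Log-square simultaneous approximations of the pair `(u, e^u)`** by algebraic points of BOUNDED
degree and LOGARITHMIC size: a fixed degree budget `N₀` and size slope `c`, and for every `m`
a scale `q ≥ m`, an irreducible `f ∈ ℤ[X]` with root `β ≠ 0` and a non-zero `S ∈ ℤ[X]` with root
`α ≠ 0`, `deg S · deg f ≤ N₀`, `log M(S), log M(f) ≤ c log q`, and
`|e^u − α| + |u − β| < exp(−m (log q)²)`. -/
def LogSqPairApprox (u : ℂ) : Prop :=
  ∃ (N₀ : ℕ) (c : ℝ), ∀ m : ℕ, ∃ q : ℕ, m ≤ q ∧ ∃ (f S : ℤ[X]) (α β : ℂ),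
    Irreducible f ∧ 0 < f.natDegree ∧ S ≠ 0 ∧ aeval β f = 0 ∧ aeval α S = 0 ∧ α ≠ 0 ∧ β ≠ 0 ∧
    S.natDegree * f.natDegree ≤ N₀ ∧
    Real.log (S.map (Int.castRingHom ℂ)).mahlerMeasure ≤ c * Real.log q ∧
    Real.log (f.map (Int.castRingHom ℂ)).mahlerMeasure ≤ c * Real.log q ∧
    ‖cexp u - α‖ + ‖u - β‖ < Real.exp (-((m : ℝ) * Real.log q ^ 2))

/-- **P1, conclusion (kernel).**  No `u ≠ 0` admits log-square simultaneous approximations of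
`(u, e^u)` (mod NW96 Thm 1): at degree `≤ N₀` and heights `≤ c log q` the two-parameter measure is
`exp(−κ (log q)²)` with `κ` INDEPENDENT of `q`, against `exp(−m (log q)²)` for every `m`. -/
theorem not_logSqPairApprox_of_NW (hNW : NesterenkoWaldschmidt1996_thm_1) {u : ℂ} (hu0 : u ≠ 0) :
    ¬ LogSqPairApprox u := by
  rintro ⟨N₀, c, h⟩
  set T : ℝ := ‖u‖ with hT
  set c' : ℝ := max c 1 with hc'
  have hc'1 : 1 ≤ c' := le_max_right _ _
  have hcc' : c ≤ c' := le_max_left _ _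
  set κ : ℝ := cNW₂ T * ((N₀ : ℝ) + 1) ^ 5 * (2 + c') ^ 2 with hκ
  have hκ0 : 0 ≤ κ := by
    have := cNW₂_pos (norm_nonneg u); rw [← hT] at this; positivity
  obtain ⟨q, hmq, f, S, α, β, hfirr, hfdeg, hS0, hβf, hαS, hα0, hβ0, hdeg, hMS, hMf, hdist⟩ :=
    h (⌈κ⌉₊ + 3)
  have hq3 : (3 : ℝ) ≤ q := by exact_mod_cast (le_trans (by omega) hmq : 3 ≤ q)
  have hlog1 : 1 ≤ Real.log q := one_le_log_of_three_le hq3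
  have hlog0 : 0 ≤ Real.log q := by linarith
  obtain ⟨hαalg, hβalg, hD1, hDle, hhα, hhβ⟩ := pair_bounds f hfirr hfdeg hβf S hS0 hαS
  -- degree `≤ N₀ + 1`, heights `≤ 1 + c' log q`
  have hN1 : (1 : ℝ) ≤ (N₀ : ℝ) + 1 := by linarith [(Nat.cast_nonneg N₀ : (0 : ℝ) ≤ N₀)]
  have hDN : (Module.finrank ℚ ↥(IntermediateField.adjoin ℚ ({α, β} : Set ℂ)) : ℝ) ≤ (N₀ : ℝ) + 1 := by
    have : Module.finrank ℚ ↥(IntermediateField.adjoin ℚ ({α, β} : Set ℂ)) ≤ N₀ := hDle.trans hdeg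
    have : (Module.finrank ℚ ↥(IntermediateField.adjoin ℚ ({α, β} : Set ℂ)) : ℝ) ≤ N₀ := by
      exact_mod_cast this
    linarith
  have hcl : c * Real.log q ≤ c' * Real.log q := mul_le_mul_of_nonneg_right hcc' hlog0
  have hL1 : (1 : ℝ) ≤ 1 + c' * Real.log q := by nlinarith
  have hhα' : weilHeight₁ (IntermediateField.adjoin ℚ ({α, β} : Set ℂ)) (fun _ : Unit => α) ≤
      1 + c' * Real.log q := by linarith
  have hhβ' : weilHeight₁ (IntermediateField.adjoin ℚ ({α, β} : Set ℂ)) (fun _ : Unit => β) ≤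
      1 + c' * Real.log q := by linarith
  have hlow := expPair_lower_bound_deg_height hNW hu0 hα0 hβ0 hαalg hβalg hN1 hL1 hDN hhα' hhβ'
  -- `(1 + L)² = (2 + c' log q)² ≤ (2 + c')² (log q)²`
  have hsq : (1 + (1 + c' * Real.log q)) ^ 2 ≤ (2 + c') ^ 2 * Real.log q ^ 2 := by
    have h1 : 1 + (1 + c' * Real.log q) ≤ (2 + c') * Real.log q := by nlinarith
    have h0 : 0 ≤ 1 + (1 + c' * Real.log q) := by nlinarith
    calc (1 + (1 + c' * Real.log q)) ^ 2 ≤ ((2 + c') * Real.log q) ^ 2 := pow_le_pow_left₀ h0 h1 2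
      _ = (2 + c') ^ 2 * Real.log q ^ 2 := by ring
  have hκle : cNW₂ T * ((N₀ : ℝ) + 1) ^ 5 * (1 + (1 + c' * Real.log q)) ^ 2 ≤ κ * Real.log q ^ 2 := by
    have h0 : 0 ≤ cNW₂ T * ((N₀ : ℝ) + 1) ^ 5 := by
      have := cNW₂_pos (norm_nonneg u); rw [← hT] at this; positivity
    calc cNW₂ T * ((N₀ : ℝ) + 1) ^ 5 * (1 + (1 + c' * Real.log q)) ^ 2
        ≤ cNW₂ T * ((N₀ : ℝ) + 1) ^ 5 * ((2 + c') ^ 2 * Real.log q ^ 2) :=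
          mul_le_mul_of_nonneg_left hsq h0
      _ = κ * Real.log q ^ 2 := by rw [hκ]; ring
  have hlow' : Real.exp (-(κ * Real.log q ^ 2)) ≤ ‖cexp u - α‖ + ‖u - β‖ :=
    le_trans (Real.exp_le_exp.mpr (neg_le_neg hκle)) hlow
  -- `exp(−(⌈κ⌉ + 3)(log q)²) ≤ exp(−κ (log q)²)`
  have hup : Real.exp (-(((⌈κ⌉₊ + 3 : ℕ) : ℝ) * Real.log q ^ 2)) ≤ Real.exp (-(κ * Real.log q ^ 2)) := by
    rw [Real.exp_le_exp, neg_le_neg_iff]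
    refine mul_le_mul_of_nonneg_right ?_ (by positivity)
    push_cast
    linarith [Nat.le_ceil κ]
  linarith [hdist.trans_le hup]

end Summit.Schanuel.Schanuel.Theorems.RootDecomp1KGeneric
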